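import Summits.QuantumFields.YangMills.Theorems.BalabanUVNodesN21ShellSplitSelected13CoPHDefs
import Mathlib.Analysis.SpecificLimits.Basic

/-!
# N21 (NE7c) · THE DIALS OF THE SELECTED ∕ GAPPED TOP CUT: from a summable relative two-run closeness `δ_K ≤ 1/16` a width letter `ρ_K` and a depth letter `n_K` with
# `Σ_K 1/(n_K+1) < ∞`, `0 ≤ ρ_K ≤ 1`, `(1 − ρ_K)^{n_K+2} ≥ 1/2` ([LF-I] p.181's factor), `2δ_K ≤ ρ_K`, and `δ_K ≤ (1 − ρ_K)^i ρ_K` at every grid depth `i ≤ n_K + 2`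
# — so that along dag-n21-d's grid `θ_i = ε_k(1 − ρ)^i` every collar step clears the closeness `ε_k δ_K` and every letter stays above `ε_k/2`

Track A of `YM-PLAN.md` (cell `pub-ymgap`, HUMAN RULING D-0062 ∕ D-0149 width seats), node **N21** (NE7c, NOT PRINTED); WIDTH SEAT `pub-ymgap-dag-n21-w2` (gen 3).  THEOREMS ONLY:
0 `def`, 0 `sorry`; COUNT-NEUTRAL; `--kind proof --supports stmt-QuantumFields-20544 --as helper` (K3⁷).  Imports dag-n21-d's definition lane `…N21ShellSplitSelected13CoPHDefs`
(p604430 ✓: `cutGrid`, `cutGrid_succ`, `WidthLetter₁₃CoPH` (via `…ShellSplitOfRecord13CoPHDefs`), `DepthLetter₁₃CoPH`) and `Mathlib.Analysis.SpecificLimits.Basic`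
(`summable_geometric_of_lt_one`).  No Theses import; restates nothing; cites by name.

WHY (the lane owner's located residual, dag-n21-d g11 `ROAD-S.md` §2, verbatim): «Dials: `n_K` with `Σ 1/(n_K+1) < ∞`, `ρ_K` with `(1−ρ_K)^{n_K+2} ≥ 1/2` ([LF-I] p.181's factor) and
`ρ_K ≥ Δ_K/ε` — compatible when N16's closeness is geometric in `K`.»  dag-n21-d's (M1)-free top cuts (selected R1–R4, gapped U1–U7) read two LETTERS per tuple and comparison
index: a relative width `ρ : WidthLetter₁₃CoPH N` and a grid depth `n : DepthLetter₁₃CoPH N`, under the rows `0 ≤ ρ_K ≤ 1` and `Summable (K ↦ 1/(n_K+1))` (R2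
`shellWeightBound_crTop₁₃VAt`, U6 `shellWeightBound_crGap₁₃VAt`); the consumer's junction (this seat's companion `…N21GappedCollarDesignIJunction`) needs IN ADDITION that at the
selected depth `i⋆ ≤ n_K` the collar `(θ_{i⋆+2}, θ_{i⋆+1}, θ_{i⋆})` clears the two-run closeness `Δ_K` on both sides, i.e. in threshold units `δ_K := Δ_K/ε_k`:
`δ_K ≤ (1 − ρ_K)^{i⋆+1} ρ_K` (and `≤ (1 − ρ_K)^{i⋆} ρ_K`), and [LF-I] p. 181 («for these we change the regularity conditions by a factor») is honoured when every letter used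
stays within a factor `2` of the threshold of record: `(1 − ρ_K)^{n_K+2} ≥ 1/2`.  THIS FILE produces such dials from ONE displayed input — a relative closeness `δ_K` with
`0 ≤ δ_K ≤ 1/16` and `Σ_K δ_K < ∞` (a fortiori a geometric one `δ_K ≤ C q^K`, `C ≤ 1/16`) — and reads the output at dag-n21-d's `cutGrid` BY NAME (§1) and in the tuple-indexed
letter types (§3).  Witness: `d_K := max(δ_K, 2^{-K}/16)`, `ρ_K := 2 d_K`, `n_K := ⌊1/(32 d_K)⌋`; then `1/(n_K+1) < 32 d_K ≤ 32(δ_K + 2^{-K}/16)` (summable), `(n_K+2)ρ_K ≤ 1/16 + 4d_K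
≤ 5/16` so Bernoulli gives `(1 − ρ_K)^{n_K+2} ≥ 11/16 ≥ 1/2`, and `(1 − ρ_K)^i ρ_K ≥ ρ_K/2 = d_K ≥ δ_K` for `i ≤ n_K + 2`.

WHAT IS PROVED ([bookkeeping] at `cutGrid` + [folklore] real analysis).
* §1 grid: `cutGrid_sub_cutGrid_succ` (`θ_i − θ_{i+1} = ε_k(1−ρ)^i ρ`) · ★ `cutGrid_succ_add_le_cutGrid` (`0 ≤ ε_k`, `δ ≤ (1−ρ)^i ρ` ⇒ `θ_{i+1} + ε_k δ ≤ θ_i`) · `one_sub_pow_mul_anti` ·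
  ★ `cutGrid_collar_clears` (the collar `(θ_{i+2}, θ_{i+1}, θ_i)` clears `ε_k δ` on BOTH sides from the single row `δ ≤ (1−ρ)^{i+1} ρ`, `0 ≤ ρ ≤ 1`) · ★ `half_eps_le_cutGrid`
  (`1/2 ≤ (1−ρ)^{n+2}`, `i ≤ n+2` ⇒ `ε_k/2 ≤ θ_i`) · `cutGrid_le_eps`.
* §2 dials: `half_le_one_sub_pow` (Bernoulli: `m ρ ≤ 1/2` ⇒ `1/2 ≤ (1−ρ)^m`) · `exists_pos_majorant` (pad `max(δ_K, 2^{-K}/16)`) · ★★ `exists_dials_of_summable` · `exists_dials_of_geometric`.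
* §3 letters: ★★ `exists_widthDepthLetters_of_summable` (per tuple `(F, θ, hP, g₀, os)`: a closeness letter `δ : WidthLetter₁₃CoPH N` with the displayed rows at every tuple ⇒ `∃ (ρ :
  WidthLetter₁₃CoPH N) (n : DepthLetter₁₃CoPH N)` carrying R2∕U6's binders `0 ≤ ρ ≤ 1`, `Summable (1/(n+1))` and the compatibility rows at every tuple) · `…_of_geometric`.
* §4 ★ `collar_rows_of_dials` — the dials' rows at one `K` + `0 ≤ ε_k` ⇒ at EVERY depth `i ≤ n` the four collar rows at `cutGrid` (both clearances, `ε_k/2 ≤ θ_{i+2}`, `θ_i ≤ ε_k`).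

HONEST FRAMING.  Elementary real analysis + bookkeeping; the closeness letter `δ` (N16's two-run sup-closeness of the tested cube statistics in threshold units — NE3 species, NOT PRINTED)
is a DISPLAYED HYPOTHESIS, inhabited for no family here; no reading is typed; nothing of Bałaban's asserted or used; NE7c NOT PRINTED ∕ NOT proved at print's fixed thresholds; **N21 NOT
discharged**; K3⁷ NOT claimed; counts UNMOVED (typed 28∕28 · discharged 5∕27); never a count claim.  One finite four-torus programme at fixed `ε` — NOT ℝ⁴, NOT infinite volume, NOT OS,
NOT a mass gap, NOT the Clay problem.  No decl below carries a cite tag.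
-/

open Finset

namespace Summit.QuantumFields.YangMills.Theorems.N21GappedTopCutDials

open Literature.MathematicalPhysics.QuantumFieldTheory.Balaban1983to89
open Literature.MathematicalPhysics.QuantumFieldTheory.Balaban1983to89.T4Continuum
open Literature.MathematicalPhysics.QuantumFieldTheory.Balaban1983to89.Node00
open Summit.QuantumFields.YangMills.Theorems.N21ShellSplitOfRecord13CoPH (cutGrid cutGrid_succ cutGrid_zero WidthLetter₁₃CoPH DepthLetter₁₃CoPH)

/-! ## §1 The grid `θ_i = ε_k(1 − ρ)^i`: collar steps against a closeness, and the factor-two window -/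

section Grid

variable (ν : Stage7Numerics) (g : ℕ → ℝ) (k : ℕ)

/-- One grid step is `θ_i − θ_{i+1} = ε_k (1 − ρ)^i ρ`. [bookkeeping] -/
theorem cutGrid_sub_cutGrid_succ (ρ : ℝ) (i : ℕ) :
    cutGrid ν g k ρ i - cutGrid ν g k ρ (i + 1) = epsOfRecord ν g k * ((1 - ρ) ^ i * ρ) := by
  rw [cutGrid_succ]; unfold cutGrid; ring

/-- ★ **A GRID STEP CLEARS A CLOSENESS `ε_k δ` as soon as `δ ≤ (1 − ρ)^i ρ`** (`0 ≤ ε_k`): `θ_{i+1} + ε_k δ ≤ θ_i`. [bookkeeping] -/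
theorem cutGrid_succ_add_le_cutGrid (hε : 0 ≤ epsOfRecord ν g k) {ρ δ : ℝ} {i : ℕ} (hδ : δ ≤ (1 - ρ) ^ i * ρ) :
    cutGrid ν g k ρ (i + 1) + epsOfRecord ν g k * δ ≤ cutGrid ν g k ρ i := by
  have h := cutGrid_sub_cutGrid_succ ν g k ρ i
  have h2 : epsOfRecord ν g k * δ ≤ epsOfRecord ν g k * ((1 - ρ) ^ i * ρ) := mul_le_mul_of_nonneg_left hδ hε
  linarith

/-- The compatibility row is monotone down the grid: `(1 − ρ)^{j} ρ ≤ (1 − ρ)^{i} ρ` for `i ≤ j`, `0 ≤ ρ ≤ 1`. [folklore] -/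
theorem one_sub_pow_mul_anti {ρ : ℝ} (hρ0 : 0 ≤ ρ) (hρ1 : ρ ≤ 1) {i j : ℕ} (hij : i ≤ j) :
    (1 - ρ) ^ j * ρ ≤ (1 - ρ) ^ i * ρ :=
  mul_le_mul_of_nonneg_right (pow_le_pow_of_le_one (by linarith) (by linarith) hij) hρ0

/-- ★ **THE SELECTED COLLAR CLEARS THE CLOSENESS ON BOTH SIDES.**  Along the grid, with `0 ≤ ε_k`, `0 ≤ ρ ≤ 1` and the single row `δ ≤ (1 − ρ)^{i+1} ρ`: the collar
`(θlo, θ, θhi) = (θ_{i+2}, θ_{i+1}, θ_i)` of dag-n21-d's gapped top cut at depth `i` satisfies `θlo + ε_k δ ≤ θ` AND `θ + ε_k δ ≤ θhi` — the two hypotheses of the companion's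
`smallInd_gap_le_mul` ∕ `largeInd_gap_le_mul` with `Δ := ε_k δ`. [bookkeeping] -/
theorem cutGrid_collar_clears (hε : 0 ≤ epsOfRecord ν g k) {ρ δ : ℝ} (hρ0 : 0 ≤ ρ) (hρ1 : ρ ≤ 1) {i : ℕ} (hδ : δ ≤ (1 - ρ) ^ (i + 1) * ρ) :
    cutGrid ν g k ρ (i + 2) + epsOfRecord ν g k * δ ≤ cutGrid ν g k ρ (i + 1) ∧
      cutGrid ν g k ρ (i + 1) + epsOfRecord ν g k * δ ≤ cutGrid ν g k ρ i :=
  ⟨cutGrid_succ_add_le_cutGrid ν g k hε hδ,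
    cutGrid_succ_add_le_cutGrid ν g k hε (hδ.trans (one_sub_pow_mul_anti hρ0 hρ1 (Nat.le_succ i)))⟩

/-- ★ **THE FACTOR-TWO WINDOW** ([LF-I] p.181 «we change the regularity conditions by a factor»): if `(1 − ρ)^{n+2} ≥ 1/2` (`0 ≤ ε_k`, `0 ≤ ρ ≤ 1`) then every grid letter down to depth
`n + 2` — in particular all three letters of any selected collar at depth `i ≤ n` — is at least `ε_k / 2`. [bookkeeping] -/
theorem half_eps_le_cutGrid (hε : 0 ≤ epsOfRecord ν g k) {ρ : ℝ} (hρ0 : 0 ≤ ρ) (hρ1 : ρ ≤ 1) {n i : ℕ} (hhalf : (1 : ℝ) / 2 ≤ (1 - ρ) ^ (n + 2)) (hi : i ≤ n + 2) :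
    epsOfRecord ν g k / 2 ≤ cutGrid ν g k ρ i := by
  have h1 : (1 : ℝ) / 2 ≤ (1 - ρ) ^ i := hhalf.trans (pow_le_pow_of_le_one (by linarith) (by linarith) hi)
  unfold cutGrid
  calc epsOfRecord ν g k / 2 = epsOfRecord ν g k * (1 / 2) := by ring
    _ ≤ epsOfRecord ν g k * (1 - ρ) ^ i := mul_le_mul_of_nonneg_left h1 hε

/-- … and (trivially) at most `ε_k`. [bookkeeping] -/
theorem cutGrid_le_eps (hε : 0 ≤ epsOfRecord ν g k) {ρ : ℝ} (hρ0 : 0 ≤ ρ) (hρ1 : ρ ≤ 1) (i : ℕ) : cutGrid ν g k ρ i ≤ epsOfRecord ν g k :=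
  mul_le_of_le_one_right hε (pow_le_one₀ (by linarith) (by linarith))

end Grid

/-! ## §2 The dials from a summable relative closeness -/

section Dials

/-- Bernoulli: `m ρ ≤ 1/2` gives `1/2 ≤ (1 − ρ)^m` (for `m ≥ 1` this forces `ρ ≤ 1/2`; `m = 0` is trivial). [folklore] -/
theorem half_le_one_sub_pow {ρ : ℝ} {m : ℕ} (hm : (m : ℝ) * ρ ≤ 1 / 2) : (1 : ℝ) / 2 ≤ (1 - ρ) ^ m := by
  rcases Nat.eq_zero_or_pos m with h | h
  · subst h; norm_num
  · have h1 : (1 : ℝ) ≤ m := by exact_mod_cast h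
    have hρ2 : ρ ≤ 2 := by nlinarith
    have hB := one_add_mul_le_pow (show (-2 : ℝ) ≤ -ρ by linarith) m
    have e : (1 : ℝ) + -ρ = 1 - ρ := by ring
    rw [e] at hB
    linarith

/-- A positive summable MAJORANT below `1/16` of a nonnegative summable sequence below `1/16` (pad with `2^{-K}/16`): the dials read a positive closeness. [folklore] -/
theorem exists_pos_majorant {δ : ℕ → ℝ} (h0 : ∀ K, 0 ≤ δ K) (h16 : ∀ K, δ K ≤ 1 / 16) (hs : Summable δ) :
    ∃ d : ℕ → ℝ, (∀ K, 0 < d K) ∧ (∀ K, d K ≤ 1 / 16) ∧ (∀ K, δ K ≤ d K) ∧ Summable d := by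
  have hb0 : ∀ K : ℕ, (0 : ℝ) < 1 / 16 * (1 / 2) ^ K := fun K => by positivity
  have hb16 : ∀ K : ℕ, (1 : ℝ) / 16 * (1 / 2) ^ K ≤ 1 / 16 := fun K =>
    mul_le_of_le_one_right (by norm_num) (pow_le_one₀ (by norm_num) (by norm_num))
  have hbs : Summable (fun K : ℕ => (1 : ℝ) / 16 * (1 / 2) ^ K) :=
    (summable_geometric_of_lt_one (by norm_num) (by norm_num)).mul_left (1 / 16)
  refine ⟨fun K => max (δ K) (1 / 16 * (1 / 2) ^ K), fun K => lt_max_of_lt_right (hb0 K), fun K => max_le (h16 K) (hb16 K),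
    fun K => le_max_left _ _, ?_⟩
  refine Summable.of_nonneg_of_le (fun K => (h0 K).trans (le_max_left _ _)) (fun K => ?_) (hs.add hbs)
  exact max_le (le_add_of_nonneg_right (hb0 K).le) (le_add_of_nonneg_left (h0 K))

/-- ★★ **THE DIALS.**  From a relative two-run closeness `δ_K` with `0 ≤ δ_K ≤ 1/16` and `Σ_K δ_K < ∞`: a width `ρ_K` and a depth `n_K` with `0 ≤ ρ_K ≤ 1`, `Σ_K 1/(n_K+1) < ∞`
(dag-n21-d's rows), `2δ_K ≤ ρ_K`, `(1 − ρ_K)^{n_K+2} ≥ 1/2` ([LF-I] p.181's factor) and the collar compatibility `δ_K ≤ (1 − ρ_K)^i ρ_K` at EVERY depth `i ≤ n_K + 2` (so at the selected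
`i⋆ ≤ n_K` and at `i⋆ + 1`).  Witness: `ρ_K = 2 d_K`, `n_K = ⌊1/(32 d_K)⌋` for the positive majorant `d` of `exists_pos_majorant`. [folklore] -/
theorem exists_dials_of_summable {δ : ℕ → ℝ} (h0 : ∀ K, 0 ≤ δ K) (h16 : ∀ K, δ K ≤ 1 / 16) (hs : Summable δ) :
    ∃ (ρ : ℕ → ℝ) (n : ℕ → ℕ),
      (∀ K, 0 ≤ ρ K) ∧ (∀ K, ρ K ≤ 1) ∧ Summable (fun K => 1 / ((n K : ℝ) + 1)) ∧
      (∀ K, 2 * δ K ≤ ρ K) ∧ (∀ K, (1 : ℝ) / 2 ≤ (1 - ρ K) ^ (n K + 2)) ∧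
      (∀ K i, i ≤ n K + 2 → δ K ≤ (1 - ρ K) ^ i * ρ K) := by
  obtain ⟨d, hd0, hd16, hδd, hds⟩ := exists_pos_majorant h0 h16 hs
  -- the factor-two window at the chosen depth, by Bernoulli
  have hhalf : ∀ K, (1 : ℝ) / 2 ≤ (1 - 2 * d K) ^ (⌊1 / (32 * d K)⌋₊ + 2) := by
    intro K
    refine half_le_one_sub_pow ?_
    have h32 : 0 < 32 * d K := by linarith [hd0 K]
    have hdne : d K ≠ 0 := (hd0 K).ne'
    have hfl : (⌊1 / (32 * d K)⌋₊ : ℝ) ≤ 1 / (32 * d K) := Nat.floor_le (le_of_lt (by positivity))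
    have e : (1 / (32 * d K) + 2) * (2 * d K) = 1 / 16 + 4 * d K := by
      field_simp
      ring
    push_cast
    have hstep : ((⌊1 / (32 * d K)⌋₊ : ℝ) + 2) * (2 * d K) ≤ (1 / (32 * d K) + 2) * (2 * d K) :=
      mul_le_mul_of_nonneg_right (by linarith) (by linarith [hd0 K])
    rw [e] at hstep
    linarith [hd16 K]
  refine ⟨fun K => 2 * d K, fun K => ⌊1 / (32 * d K)⌋₊, fun K => by linarith [hd0 K], fun K => by linarith [hd16 K], ?_,
    fun K => by linarith [hδd K], hhalf, fun K i hi => ?_⟩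
  · -- `1/(n_K + 1) < 32 d_K`, summable
    refine Summable.of_nonneg_of_le (fun K => by positivity) (fun K => ?_) (hds.mul_left 32)
    have h32 : 0 < 32 * d K := by linarith [hd0 K]
    have hlt : 1 / (32 * d K) < (⌊1 / (32 * d K)⌋₊ : ℝ) + 1 := Nat.lt_floor_add_one _
    have hfl0 : (0 : ℝ) < (⌊1 / (32 * d K)⌋₊ : ℝ) + 1 := by positivity
    rw [div_le_iff₀ hfl0]
    have h1 : 32 * d K * (1 / (32 * d K)) = 1 := mul_one_div_cancel h32.ne'
    linarith [mul_lt_mul_of_pos_left hlt h32]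
  · -- compatibility at depth `i ≤ n_K + 2`: `(1 − ρ)^i ρ ≥ ρ/2 = d ≥ δ`
    have hρ0 : 0 ≤ 2 * d K := by linarith [hd0 K]
    have hpow : (1 : ℝ) / 2 ≤ (1 - 2 * d K) ^ i :=
      (hhalf K).trans (pow_le_pow_of_le_one (by linarith [hd16 K]) (by linarith [hd0 K]) hi)
    calc δ K ≤ d K := hδd K
      _ = 1 / 2 * (2 * d K) := by ring
      _ ≤ (1 - 2 * d K) ^ i * (2 * d K) := mul_le_mul_of_nonneg_right hpow hρ0

/-- **GEOMETRIC CLOSENESS** (dag-n21-d: «compatible when N16's closeness is geometric in `K`»): `0 ≤ δ_K ≤ C q^K` with `C ≤ 1/16`, `0 ≤ q < 1` gives the dials. [folklore] -/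
theorem exists_dials_of_geometric {δ : ℕ → ℝ} {C q : ℝ} (h0 : ∀ K, 0 ≤ δ K) (hδ : ∀ K, δ K ≤ C * q ^ K) (hC : C ≤ 1 / 16) (hq0 : 0 ≤ q) (hq1 : q < 1) :
    ∃ (ρ : ℕ → ℝ) (n : ℕ → ℕ),
      (∀ K, 0 ≤ ρ K) ∧ (∀ K, ρ K ≤ 1) ∧ Summable (fun K => 1 / ((n K : ℝ) + 1)) ∧
      (∀ K, 2 * δ K ≤ ρ K) ∧ (∀ K, (1 : ℝ) / 2 ≤ (1 - ρ K) ^ (n K + 2)) ∧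
      (∀ K i, i ≤ n K + 2 → δ K ≤ (1 - ρ K) ^ i * ρ K) := by
  have hC0 : 0 ≤ C := by simpa using (h0 0).trans (hδ 0)
  refine exists_dials_of_summable h0 (fun K => (hδ K).trans ?_) ?_
  · exact (mul_le_of_le_one_right hC0 (pow_le_one₀ hq0 hq1.le)).trans hC
  · exact Summable.of_nonneg_of_le h0 hδ ((summable_geometric_of_lt_one hq0 hq1).mul_left C)

end Dials

/-! ## §3 The letter form: width and depth letters of dag-n21-d's readings from a closeness letter -/

section Letters

variable {N : ℕ} [NeZero N]

/-- ★★ **WIDTH AND DEPTH LETTERS FROM A CLOSENESS LETTER.**  If at every tuple `(F, θ, hP, g₀, os)` the relative two-run closeness letter `δ` (N16's, in threshold units; DISPLAYED)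
satisfies `0 ≤ δ_K ≤ 1/16` and `Σ_K δ_K < ∞`, then there are letters `ρ : WidthLetter₁₃CoPH N`, `n : DepthLetter₁₃CoPH N` carrying, at every tuple, the rows of dag-n21-d's
`shellWeightBound_crTop₁₃VAt` ∕ `shellWeightBound_crGap₁₃VAt` (`0 ≤ ρ ≤ 1`, `Summable (1/(n+1))`) AND the consumer's collar compatibility (`2δ ≤ ρ`, `(1−ρ)^{n+2} ≥ 1/2`,
`δ ≤ (1−ρ)^i ρ` for `i ≤ n + 2`).  (Pointwise `exists_dials_of_summable` + choice.) [folklore] -/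
theorem exists_widthDepthLetters_of_summable (δ : WidthLetter₁₃CoPH N)
    (h0 : ∀ (F : T4Family) (θ : Stage13HParams F N) (hP : θ.Provisos₁₃CoPH F N) (g₀ : ℕ → ℝ) (os : List (ULoop F)) (K : ℕ), 0 ≤ δ F θ hP g₀ os K)
    (h16 : ∀ (F : T4Family) (θ : Stage13HParams F N) (hP : θ.Provisos₁₃CoPH F N) (g₀ : ℕ → ℝ) (os : List (ULoop F)) (K : ℕ), δ F θ hP g₀ os K ≤ 1 / 16)
    (hs : ∀ (F : T4Family) (θ : Stage13HParams F N) (hP : θ.Provisos₁₃CoPH F N) (g₀ : ℕ → ℝ) (os : List (ULoop F)), Summable (δ F θ hP g₀ os)) :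
    ∃ (ρ : WidthLetter₁₃CoPH N) (n : DepthLetter₁₃CoPH N),
      ∀ (F : T4Family) (θ : Stage13HParams F N) (hP : θ.Provisos₁₃CoPH F N) (g₀ : ℕ → ℝ) (os : List (ULoop F)),
        (∀ K, 0 ≤ ρ F θ hP g₀ os K) ∧ (∀ K, ρ F θ hP g₀ os K ≤ 1) ∧ Summable (fun K => 1 / ((n F θ hP g₀ os K : ℝ) + 1)) ∧
        (∀ K, 2 * δ F θ hP g₀ os K ≤ ρ F θ hP g₀ os K) ∧ (∀ K, (1 : ℝ) / 2 ≤ (1 - ρ F θ hP g₀ os K) ^ (n F θ hP g₀ os K + 2)) ∧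
        (∀ K i, i ≤ n F θ hP g₀ os K + 2 → δ F θ hP g₀ os K ≤ (1 - ρ F θ hP g₀ os K) ^ i * ρ F θ hP g₀ os K) := by
  have h := fun (F : T4Family) (θ : Stage13HParams F N) (hP : θ.Provisos₁₃CoPH F N) (g₀ : ℕ → ℝ) (os : List (ULoop F)) =>
    exists_dials_of_summable (h0 F θ hP g₀ os) (h16 F θ hP g₀ os) (hs F θ hP g₀ os)
  exact ⟨fun F θ hP g₀ os => Classical.choose (h F θ hP g₀ os), fun F θ hP g₀ os => Classical.choose (Classical.choose_spec (h F θ hP g₀ os)),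
    fun F θ hP g₀ os => Classical.choose_spec (Classical.choose_spec (h F θ hP g₀ os))⟩

/-- Geometric letter form: `0 ≤ δ_K ≤ C q^K` at every tuple with tuple-dependent `C ≤ 1/16`, `0 ≤ q < 1`. [folklore] -/
theorem exists_widthDepthLetters_of_geometric (δ : WidthLetter₁₃CoPH N)
    (C q : (F : T4Family) → (θ : Stage13HParams F N) → θ.Provisos₁₃CoPH F N → (ℕ → ℝ) → List (ULoop F) → ℝ)
    (h0 : ∀ (F : T4Family) (θ : Stage13HParams F N) (hP : θ.Provisos₁₃CoPH F N) (g₀ : ℕ → ℝ) (os : List (ULoop F)) (K : ℕ), 0 ≤ δ F θ hP g₀ os K)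
    (hδ : ∀ (F : T4Family) (θ : Stage13HParams F N) (hP : θ.Provisos₁₃CoPH F N) (g₀ : ℕ → ℝ) (os : List (ULoop F)) (K : ℕ),
      δ F θ hP g₀ os K ≤ C F θ hP g₀ os * q F θ hP g₀ os ^ K)
    (hC : ∀ (F : T4Family) (θ : Stage13HParams F N) (hP : θ.Provisos₁₃CoPH F N) (g₀ : ℕ → ℝ) (os : List (ULoop F)), C F θ hP g₀ os ≤ 1 / 16)
    (hq0 : ∀ (F : T4Family) (θ : Stage13HParams F N) (hP : θ.Provisos₁₃CoPH F N) (g₀ : ℕ → ℝ) (os : List (ULoop F)), 0 ≤ q F θ hP g₀ os)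
    (hq1 : ∀ (F : T4Family) (θ : Stage13HParams F N) (hP : θ.Provisos₁₃CoPH F N) (g₀ : ℕ → ℝ) (os : List (ULoop F)), q F θ hP g₀ os < 1) :
    ∃ (ρ : WidthLetter₁₃CoPH N) (n : DepthLetter₁₃CoPH N),
      ∀ (F : T4Family) (θ : Stage13HParams F N) (hP : θ.Provisos₁₃CoPH F N) (g₀ : ℕ → ℝ) (os : List (ULoop F)),
        (∀ K, 0 ≤ ρ F θ hP g₀ os K) ∧ (∀ K, ρ F θ hP g₀ os K ≤ 1) ∧ Summable (fun K => 1 / ((n F θ hP g₀ os K : ℝ) + 1)) ∧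
        (∀ K, 2 * δ F θ hP g₀ os K ≤ ρ F θ hP g₀ os K) ∧ (∀ K, (1 : ℝ) / 2 ≤ (1 - ρ F θ hP g₀ os K) ^ (n F θ hP g₀ os K + 2)) ∧
        (∀ K i, i ≤ n F θ hP g₀ os K + 2 → δ F θ hP g₀ os K ≤ (1 - ρ F θ hP g₀ os K) ^ i * ρ F θ hP g₀ os K) := by
  have h := fun (F : T4Family) (θ : Stage13HParams F N) (hP : θ.Provisos₁₃CoPH F N) (g₀ : ℕ → ℝ) (os : List (ULoop F)) =>
    exists_dials_of_geometric (h0 F θ hP g₀ os) (hδ F θ hP g₀ os) (hC F θ hP g₀ os) (hq0 F θ hP g₀ os) (hq1 F θ hP g₀ os)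
  exact ⟨fun F θ hP g₀ os => Classical.choose (h F θ hP g₀ os), fun F θ hP g₀ os => Classical.choose (Classical.choose_spec (h F θ hP g₀ os)),
    fun F θ hP g₀ os => Classical.choose_spec (Classical.choose_spec (h F θ hP g₀ os))⟩

end Letters

/-! ## §4 Reading the dials on the grid: at every depth `i ≤ n_K` the selected collar clears `ε_k δ_K` and stays in the factor-two window -/

section OnGrid

/-- ★ **DIALS ⇒ COLLAR ROWS AT `cutGrid`.**  For dials as produced by `exists_dials_of_summable` (read at one `K`: `0 ≤ ρ ≤ 1`, `(1−ρ)^{n+2} ≥ 1/2`, `δ ≤ (1−ρ)^i ρ` for `i ≤ n+2`) and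
any level with `0 ≤ ε_k`: at EVERY depth `i ≤ n` the collar `(θ_{i+2}, θ_{i+1}, θ_i)` clears `ε_k δ` on both sides and all three letters lie in `[ε_k/2, ε_k]` — in particular at
dag-n21-d's selected depth `i⋆ ≤ n` (`selGapDepth₁₃_le`). [bookkeeping] -/
theorem collar_rows_of_dials (ν : Stage7Numerics) (g : ℕ → ℝ) (k : ℕ) (hε : 0 ≤ epsOfRecord ν g k) {ρ δ : ℝ} {n : ℕ}
    (hρ0 : 0 ≤ ρ) (hρ1 : ρ ≤ 1) (hhalf : (1 : ℝ) / 2 ≤ (1 - ρ) ^ (n + 2)) (hcompat : ∀ i, i ≤ n + 2 → δ ≤ (1 - ρ) ^ i * ρ)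
    {i : ℕ} (hi : i ≤ n) :
    cutGrid ν g k ρ (i + 2) + epsOfRecord ν g k * δ ≤ cutGrid ν g k ρ (i + 1) ∧
      cutGrid ν g k ρ (i + 1) + epsOfRecord ν g k * δ ≤ cutGrid ν g k ρ i ∧
      epsOfRecord ν g k / 2 ≤ cutGrid ν g k ρ (i + 2) ∧ cutGrid ν g k ρ i ≤ epsOfRecord ν g k := by
  have hc := cutGrid_collar_clears ν g k hε hρ0 hρ1 (hcompat (i + 1) (by omega))
  exact ⟨hc.1, hc.2, half_eps_le_cutGrid ν g k hε hρ0 hρ1 hhalf (by omega), cutGrid_le_eps ν g k hε hρ0 hρ1 i⟩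

end OnGrid

end Summit.QuantumFields.YangMills.Theorems.N21GappedTopCutDials
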